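import Mathlib.Topology.MetricSpace.Basic
import Mathlib.Analysis.Normed.Field.Basic
import Mathlib.FieldTheory.IsAlgClosed.Basic
import Mathlib.Algebra.Polynomial.Roots
import HarnessLib

set_option linter.dupNamespace false

/-!
# Route `route-ABC-IUTThetaPilot`, support item `GenEllTwo` (stmt-ABC-19679) — helper.
# [GenEll] Thm. 2.1, proof of (ii) ⇒ (i): the MENU COVERING LEMMA (abstract pigeonhole part)

S. Mochizuki, *Arithmetic elliptic curves in general position*, Math. J. Okayama Univ. **52** (2010)
[cite: MochizukiGenEll2010], proof of Thm. 2.1, p. 12: the points of bounded degree `d` are handled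
through "the compactness of the set of rational points … over any finite extension of `ℚ_v` for
`v ∈ V`" and a noncritical Belyi map chosen AFTER extracting a limit configuration of the `≤ d`
conjugates ("slots") of a violating sequence.  In the number-field-only architecture for the route
item `GenEllTwo` (cell abc-iut, package GENELLTWO-P1ROUTE §4, owner abc-iut-S6) the compactness
argument is replaced by a FINITE MENU of cusp-preserving self-maps `γ` of `ℙ¹` (composites of an
"inner" family `g_n` and an "outer" family `f_p`) and a pigeonhole over the `≤ 2d` conjugate slots of
a point: some member of the menu moves EVERY slot away from the finite bad set `X` (= the
`x`-coordinates of the special fibre `E_φ` of the noncritical Belyi map).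

This file is the ABSTRACT part of that covering lemma — pure metric-space bookkeeping, no number
theory:

* `exists_radii` — for ONE slot space: from the two ALGEBRAIC persistence hypotheses
  (outer: `f_p ⁻¹' X ∩ f_{p'} ⁻¹' X ⊆ T` for `p ≠ p'`; inner: `g_n ⁻¹' T ∩ g_{n'} ⁻¹' T = ∅` for
  `n ≠ n'`), finiteness of the preimage sets and localization, radii `r, η > 0` such that a point `u`
  with TWO outer images `r`-near `X` is `η`-near `T`, and NO point has two inner images `η`-near `T`;
* `exists_good_pair_abstract`, `exists_good_pair₂` — the pigeonhole (pure combinatorics, then for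
  two slot spaces, instances `ℂ` and `Q̄_2`): with menus larger than the number of slots, some pair
  `(n, p)` has `f_p (g_n z)` `r`-far from `X` for EVERY slot `z` (greedy choice: each slot forbids at
  most one `n`, then at most one `p`);
* `localizes_eval`, `finite_preimage_eval` — the two analytic inputs for polynomial maps over an
  algebraically closed normed field (`ℂ`, `PadicAlgCl p`), by the factorisation
  `P(u) − a = c · ∏ (u − y)` over the roots.

Deliberately NOT here: the persistence hypotheses for the actual families (`x ↦ x^p` and the
conjugated Chebyshev maps — heights, Kronecker's theorem; sibling file `GenEllMenuPersistence`), the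
number-field wrapper (slots = conjugates of `x` at `∞` and at `2`), and anything about Vojta's
inequality.  Everything here is classical and undisputed; nothing bears on [IUTchIII] Cor. 3.12.
-/

noncomputable section

open Metric Polynomial

namespace Summit.ABC.ABC.Theorems.GenEllTwo.MenuCovering

section Metric

variable {E : Type*} [MetricSpace E]

/-! Throughout, "`u` is `r`-near `X`" is written `∃ x ∈ X, dist u x < r`, and "the self-map `f`
LOCALIZES at `X`" is the property `∀ ε > 0, ∃ δ > 0, ∀ u, (∃ x ∈ X, dist (f u) x < δ) →
∃ y ∈ f ⁻¹' X, dist u y < ε` (points mapped close to `X` are close to the preimage of `X`,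
uniformly); no definitions are introduced (proof-only helper file). -/

/-- Monotonicity of nearness in the radius. [folklore] -/
private theorem near_mono {r r' : ℝ} (h : r ≤ r') {X : Set E} {u : E}
    (hu : ∃ x ∈ X, dist u x < r) : ∃ x ∈ X, dist u x < r' := by
  obtain ⟨x, hx, hd⟩ := hu
  exact ⟨x, hx, lt_of_lt_of_le hd h⟩

/-- A positive function on a finite set has a positive lower bound. [folklore] -/
theorem exists_pos_forall_le {α : Type*} {S : Set α} (hS : S.Finite) (g : α → ℝ)
    (hg : ∀ y ∈ S, 0 < g y) : ∃ c > 0, ∀ y ∈ S, c ≤ g y := by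
  induction S, hS using Set.Finite.induction_on with
  | empty => exact ⟨1, one_pos, fun y hy => hy.elim⟩
  | @insert a s _ _ ih =>
    obtain ⟨c, hc, hcs⟩ := ih (fun y hy => hg y (Set.mem_insert_of_mem _ hy))
    refine ⟨min c (g a), lt_min hc (hg a (Set.mem_insert _ _)), fun y hy => ?_⟩
    rcases Set.mem_insert_iff.mp hy with rfl | hy
    · exact min_le_right _ _
    · exact (min_le_left _ _).trans (hcs y hy)

/-- SEPARATION of a finite subset of a metric space: some `η > 0` such that two points of the set at
distance `< 2η` are equal. [folklore] -/
theorem exists_separation {S : Set E} (hS : S.Finite) :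
    ∃ η > 0, ∀ y ∈ S, ∀ y' ∈ S, dist y y' < 2 * η → y = y' := by
  induction S, hS using Set.Finite.induction_on with
  | empty => exact ⟨1, one_pos, fun y hy => hy.elim⟩
  | @insert a s ha hs ih =>
    obtain ⟨η, hη, hsep⟩ := ih
    -- positive lower bound for the distances from `a` to the old points
    obtain ⟨c, hc, hcs⟩ := exists_pos_forall_le hs (fun y => dist a y)
      (fun y hy => dist_pos.mpr (fun h => ha (h ▸ hy)))
    refine ⟨min η (c / 2), lt_min hη (by positivity), fun y hy y' hy' hd => ?_⟩
    have hη' : 2 * min η (c / 2) ≤ 2 * η := by gcongr; exact min_le_left _ _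
    have hc' : 2 * min η (c / 2) ≤ c := by
      have := min_le_right η (c / 2); linarith
    rcases Set.mem_insert_iff.mp hy with h1 | h1
    · rcases Set.mem_insert_iff.mp hy' with h2 | h2
      · rw [h1, h2]
      · subst h1
        exact absurd (lt_of_lt_of_le hd hc') (not_lt.mpr (hcs y' h2))
    · rcases Set.mem_insert_iff.mp hy' with h2 | h2
      · subst h2
        rw [dist_comm] at hd
        exact absurd (lt_of_lt_of_le hd hc') (not_lt.mpr (hcs y h1))
      · exact hsep y h1 y' h2 (lt_of_lt_of_le hd hη')

/-- Uniform localization radius for a FINITE family of localizing maps. [folklore] -/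
theorem exists_uniform_delta {β : Type*} (PC : Finset β) (g : β → E → E) (T : Set E)
    (h : ∀ n ∈ PC, ∀ ε > 0, ∃ δ > 0, ∀ u, (∃ x ∈ T, dist (g n u) x < δ) →
      ∃ y ∈ g n ⁻¹' T, dist u y < ε) {ε : ℝ} (hε : 0 < ε) :
    ∃ δ > 0, ∀ n ∈ PC, ∀ u, (∃ x ∈ T, dist (g n u) x < δ) → ∃ y ∈ g n ⁻¹' T, dist u y < ε := by
  classical
  induction PC using Finset.induction_on with
  | empty => exact ⟨1, one_pos, fun n hn => by simp at hn⟩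
  | @insert a s _ ih =>
    obtain ⟨δ, hδ, hs⟩ := ih (fun n hn => h n (Finset.mem_insert_of_mem hn))
    obtain ⟨δa, hδa, ha⟩ := h a (Finset.mem_insert_self _ _) ε hε
    refine ⟨min δ δa, lt_min hδ hδa, fun n hn u hu => ?_⟩
    rcases Finset.mem_insert.mp hn with rfl | hn
    · exact ha u (near_mono (min_le_right _ _) hu)
    · exact hs n hn u (near_mono (min_le_left _ _) hu)

/-- **The radii for one slot space.**  Two families of self-maps `f_p` (outer, `p ∈ PA`) and `g_n`
(inner, `n ∈ PC`) of a metric space, a bad set `X` and a persistent set `T` with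
(outer persistence) `f_p y ∈ X ∧ f_{p'} y ∈ X → y ∈ T` for `p ≠ p'`,
(inner persistence) `¬ (g_n y ∈ T ∧ g_{n'} y ∈ T)` for `n ≠ n'`, all preimage sets finite and all
maps localizing.  Then there are `r, η > 0` with: (i) a point with two outer images `r`-near `X` is
`η`-near `T`; (ii) no point has two inner images `η`-near `T`.  (Both radii may be taken below any
prescribed bound, but this is not needed.) [cite: MochizukiGenEll2010, Thm 2.1 p.12] -/
theorem exists_radii {α β : Type*} (PA : Finset α) (PC : Finset β) (f : α → E → E)
    (g : β → E → E) (X T : Set E)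
    (hAfin : ∀ p ∈ PA, (f p ⁻¹' X).Finite)
    (hA : ∀ p ∈ PA, ∀ p' ∈ PA, p ≠ p' → ∀ y, f p y ∈ X → f p' y ∈ X → y ∈ T)
    (hAloc : ∀ p ∈ PA, ∀ ε > 0, ∃ δ > 0, ∀ u, (∃ x ∈ X, dist (f p u) x < δ) →
      ∃ y ∈ f p ⁻¹' X, dist u y < ε)
    (hCfin : ∀ n ∈ PC, (g n ⁻¹' T).Finite)
    (hC : ∀ n ∈ PC, ∀ n' ∈ PC, n ≠ n' → ∀ y, g n y ∈ T → g n' y ∈ T → False)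
    (hCloc : ∀ n ∈ PC, ∀ ε > 0, ∃ δ > 0, ∀ u, (∃ x ∈ T, dist (g n u) x < δ) →
      ∃ y ∈ g n ⁻¹' T, dist u y < ε) :
    ∃ r > 0, ∃ η > 0,
      (∀ u, ∀ p ∈ PA, ∀ p' ∈ PA, p ≠ p' →
        (∃ x ∈ X, dist (f p u) x < r) → (∃ x ∈ X, dist (f p' u) x < r) →
          ∃ x ∈ T, dist u x < η) ∧
      (∀ z, ∀ n ∈ PC, ∀ n' ∈ PC, n ≠ n' →
        (∃ x ∈ T, dist (g n z) x < η) → (∃ x ∈ T, dist (g n' z) x < η) → False) := by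
  -- separation of the union of the outer preimage sets
  have hSA : (⋃ p ∈ PA, f p ⁻¹' X).Finite :=
    Set.Finite.biUnion PA.finite_toSet (fun p hp => hAfin p hp)
  obtain ⟨η₁, hη₁, hsepA⟩ := exists_separation hSA
  -- separation of the union of the inner preimage sets
  have hSC : (⋃ n ∈ PC, g n ⁻¹' T).Finite :=
    Set.Finite.biUnion PC.finite_toSet (fun n hn => hCfin n hn)
  obtain ⟨η₂, hη₂, hsepC⟩ := exists_separation hSC
  -- uniform inner localization at radius `η₂`
  obtain ⟨δC, hδC, hlocC⟩ := exists_uniform_delta PC g T hCloc hη₂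
  -- the common radius `η`
  set η : ℝ := min η₁ δC with hηdef
  have hη : 0 < η := lt_min hη₁ hδC
  -- uniform outer localization at radius `η`
  obtain ⟨r, hr, hlocA⟩ := exists_uniform_delta PA f X hAloc hη
  refine ⟨r, hr, η, hη, ?_, ?_⟩
  · intro u p hp p' hp' hpp' hu hu'
    obtain ⟨y, hy, hdy⟩ := hlocA p hp u hu
    obtain ⟨y', hy', hdy'⟩ := hlocA p' hp' u hu'
    have hyS : y ∈ ⋃ p ∈ PA, f p ⁻¹' X := Set.mem_biUnion hp hy
    have hy'S : y' ∈ ⋃ p ∈ PA, f p ⁻¹' X := Set.mem_biUnion hp' hy'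
    have hd : dist y y' < 2 * η₁ := by
      calc dist y y' ≤ dist y u + dist u y' := dist_triangle _ _ _
        _ = dist u y + dist u y' := by rw [dist_comm y u]
        _ < η + η := add_lt_add hdy hdy'
        _ ≤ η₁ + η₁ := add_le_add (min_le_left _ _) (min_le_left _ _)
        _ = 2 * η₁ := by ring
    have hyy' : y = y' := hsepA y hyS y' hy'S hd
    subst hyy'
    exact ⟨y, hA p hp p' hp' hpp' y hy hy', hdy⟩
  · intro z n hn n' hn' hnn' hz hz'
    obtain ⟨y, hy, hdy⟩ := hlocC n hn z (near_mono (min_le_right _ _) hz)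
    obtain ⟨y', hy', hdy'⟩ := hlocC n' hn' z (near_mono (min_le_right _ _) hz')
    have hyS : y ∈ ⋃ n ∈ PC, g n ⁻¹' T := Set.mem_biUnion hn hy
    have hy'S : y' ∈ ⋃ n ∈ PC, g n ⁻¹' T := Set.mem_biUnion hn' hy'
    have hd : dist y y' < 2 * η₂ := by
      calc dist y y' ≤ dist y z + dist z y' := dist_triangle _ _ _
        _ = dist z y + dist z y' := by rw [dist_comm y z]
        _ < η₂ + η₂ := add_lt_add hdy hdy'
        _ = 2 * η₂ := by ring
    have hyy' : y = y' := hsepC y hyS y' hy'S hd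
    subst hyy'
    exact hC n hn n' hn' hnn' y hy hy'

end Metric

/-! ## The pigeonhole over the slots -/

section Pigeonhole

/-- **The pigeonhole, purely combinatorial form.**  Slots `s ∈ Z`, inner parameters `n ∈ PC`, outer
parameters `p ∈ PA`; each slot forbids at most one inner parameter (`badC`), and — once an allowed
inner parameter is fixed — at most one outer parameter (`badA`).  If both menus are larger than the
number of slots, some pair `(n, p)` is allowed by every slot. [cite: MochizukiGenEll2010, Thm 2.1 p.12] -/
theorem exists_good_pair_abstract {σ α β : Type*} (PA : Finset α) (PC : Finset β) (Z : Finset σ)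
    (badC : σ → β → Prop) (badA : σ → β → α → Prop)
    (hC : ∀ s ∈ Z, ∀ n ∈ PC, ∀ n' ∈ PC, badC s n → badC s n' → n = n')
    (hA : ∀ s ∈ Z, ∀ n ∈ PC, ¬ badC s n → ∀ p ∈ PA, ∀ p' ∈ PA, badA s n p → badA s n p' → p = p')
    (hPA : Z.card < PA.card) (hPC : Z.card < PC.card) :
    ∃ n ∈ PC, ∃ p ∈ PA, ∀ s ∈ Z, ¬ badC s n ∧ ¬ badA s n p := by
  classical
  -- an inner parameter allowed by every slot
  let BC : Finset β := Z.biUnion fun s => PC.filter fun n => badC s n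
  have hBC : BC.card ≤ Z.card := by
    refine le_trans Finset.card_biUnion_le ?_
    calc ∑ s ∈ Z, (PC.filter fun n => badC s n).card ≤ ∑ _s ∈ Z, 1 :=
          Finset.sum_le_sum fun s hs => Finset.card_le_one.mpr fun n hn n' hn' => by
            rw [Finset.mem_filter] at hn hn'
            exact hC s hs n hn.1 n' hn'.1 hn.2 hn'.2
      _ = Z.card := by simp
  obtain ⟨n, hnPC, hnBC⟩ : ∃ n ∈ PC, n ∉ BC := by
    by_contra hcon
    push Not at hcon
    have : PC.card ≤ BC.card := Finset.card_le_card fun n hn => hcon n hn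
    omega
  have hgood : ∀ s ∈ Z, ¬ badC s n := by
    intro s hs hbad
    apply hnBC
    simp only [BC, Finset.mem_biUnion, Finset.mem_filter]
    exact ⟨s, hs, hnPC, hbad⟩
  -- an outer parameter allowed by every slot, given `n`
  let BA : Finset α := Z.biUnion fun s => PA.filter fun p => badA s n p
  have hBA : BA.card ≤ Z.card := by
    refine le_trans Finset.card_biUnion_le ?_
    calc ∑ s ∈ Z, (PA.filter fun p => badA s n p).card ≤ ∑ _s ∈ Z, 1 :=
          Finset.sum_le_sum fun s hs => Finset.card_le_one.mpr fun p hp p' hp' => by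
            rw [Finset.mem_filter] at hp hp'
            exact hA s hs n hnPC (hgood s hs) p hp.1 p' hp'.1 hp.2 hp'.2
      _ = Z.card := by simp
  obtain ⟨p, hpPA, hpBA⟩ : ∃ p ∈ PA, p ∉ BA := by
    by_contra hcon
    push Not at hcon
    have : PA.card ≤ BA.card := Finset.card_le_card fun p hp => hcon p hp
    omega
  refine ⟨n, hnPC, p, hpPA, fun s hs => ⟨hgood s hs, fun hbad => hpBA ?_⟩⟩
  simp only [BA, Finset.mem_biUnion, Finset.mem_filter]
  exact ⟨s, hs, hpPA, hbad⟩

/-- **MENU COVERING LEMMA for two slot spaces** (the case used by `GenEllTwo`: the conjugates of a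
point at `∞`, in `ℂ`, and at `2`, in `Q̄_2`): with the radii of `exists_radii` in each space and
menus larger than the total number of slots, some pair `(n, p)` has `f_p (g_n z)` `r`-far from the
bad set for every slot `z` of either space. [cite: MochizukiGenEll2010, Thm 2.1 p.12] -/
theorem exists_good_pair₂ {E₁ E₂ α β : Type*} [MetricSpace E₁] [MetricSpace E₂]
    (PA : Finset α) (PC : Finset β)
    (f₁ : α → E₁ → E₁) (g₁ : β → E₁ → E₁) (X₁ T₁ : Set E₁) (r₁ η₁ : ℝ)
    (f₂ : α → E₂ → E₂) (g₂ : β → E₂ → E₂) (X₂ T₂ : Set E₂) (r₂ η₂ : ℝ)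
    (hout₁ : ∀ u, ∀ p ∈ PA, ∀ p' ∈ PA, p ≠ p' →
      (∃ x ∈ X₁, dist (f₁ p u) x < r₁) → (∃ x ∈ X₁, dist (f₁ p' u) x < r₁) →
        ∃ x ∈ T₁, dist u x < η₁)
    (hinn₁ : ∀ z, ∀ n ∈ PC, ∀ n' ∈ PC, n ≠ n' →
      (∃ x ∈ T₁, dist (g₁ n z) x < η₁) → (∃ x ∈ T₁, dist (g₁ n' z) x < η₁) → False)
    (hout₂ : ∀ u, ∀ p ∈ PA, ∀ p' ∈ PA, p ≠ p' →
      (∃ x ∈ X₂, dist (f₂ p u) x < r₂) → (∃ x ∈ X₂, dist (f₂ p' u) x < r₂) →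
        ∃ x ∈ T₂, dist u x < η₂)
    (hinn₂ : ∀ z, ∀ n ∈ PC, ∀ n' ∈ PC, n ≠ n' →
      (∃ x ∈ T₂, dist (g₂ n z) x < η₂) → (∃ x ∈ T₂, dist (g₂ n' z) x < η₂) → False)
    (Z₁ : Finset E₁) (Z₂ : Finset E₂)
    (hPA : Z₁.card + Z₂.card < PA.card) (hPC : Z₁.card + Z₂.card < PC.card) :
    ∃ n ∈ PC, ∃ p ∈ PA,
      (∀ z ∈ Z₁, ∀ x ∈ X₁, r₁ ≤ dist (f₁ p (g₁ n z)) x) ∧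
      (∀ z ∈ Z₂, ∀ x ∈ X₂, r₂ ≤ dist (f₂ p (g₂ n z)) x) := by
  classical
  -- encode both kinds of slots in the sum type
  let badC : E₁ ⊕ E₂ → β → Prop := fun s n =>
    match s with
    | Sum.inl z => ∃ x ∈ T₁, dist (g₁ n z) x < η₁
    | Sum.inr z => ∃ x ∈ T₂, dist (g₂ n z) x < η₂
  let badA : E₁ ⊕ E₂ → β → α → Prop := fun s n p =>
    match s with
    | Sum.inl z => ∃ x ∈ X₁, dist (f₁ p (g₁ n z)) x < r₁
    | Sum.inr z => ∃ x ∈ X₂, dist (f₂ p (g₂ n z)) x < r₂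
  have hcard : (Z₁.disjSum Z₂).card = Z₁.card + Z₂.card := Finset.card_disjSum _ _
  obtain ⟨n, hn, p, hp, hall⟩ := exists_good_pair_abstract PA PC (Z₁.disjSum Z₂) badC badA
    (by
      intro s hs n hn n' hn' h h'
      by_contra hne
      rcases s with z | z
      · exact hinn₁ z n hn n' hn' hne h h'
      · exact hinn₂ z n hn n' hn' hne h h')
    (by
      intro s hs n hn hgood p hp p' hp' h h'
      by_contra hne
      rcases s with z | z
      · exact hgood (hout₁ (g₁ n z) p hp p' hp' hne h h')
      · exact hgood (hout₂ (g₂ n z) p hp p' hp' hne h h'))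
    (by rw [hcard]; exact hPA) (by rw [hcard]; exact hPC)
  refine ⟨n, hn, p, hp, fun z hz x hx => ?_, fun z hz x hx => ?_⟩
  · have h := (hall (Sum.inl z) (Finset.inl_mem_disjSum.mpr hz)).2
    by_contra hlt
    push Not at hlt
    exact h ⟨x, hx, hlt⟩
  · have h := (hall (Sum.inr z) (Finset.inr_mem_disjSum.mpr hz)).2
    by_contra hlt
    push Not at hlt
    exact h ⟨x, hx, hlt⟩

end Pigeonhole

/-! ## Polynomial maps of an algebraically closed normed field localize -/

section Poly

variable {K : Type*} [NormedField K]

/-- Lower bound for a product of distances: if every `y ∈ s` is at distance `≥ ε` from `u`, then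
`ε ^ #s ≤ ‖∏_{y ∈ s} (u − y)‖`. [folklore] -/
theorem pow_card_le_norm_prod (u : K) {ε : ℝ} (hε : 0 ≤ ε) (s : Multiset K)
    (h : ∀ y ∈ s, ε ≤ ‖u - y‖) :
    ε ^ Multiset.card s ≤ ‖(s.map fun y => u - y).prod‖ := by
  induction s using Multiset.induction_on with
  | empty => simp
  | cons a s ih =>
    have ha : ε ≤ ‖u - a‖ := h a (Multiset.mem_cons_self _ _)
    have hs : ∀ y ∈ s, ε ≤ ‖u - y‖ := fun y hy => h y (Multiset.mem_cons_of_mem hy)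
    rw [Multiset.map_cons, Multiset.prod_cons, norm_mul, Multiset.card_cons, pow_succ']
    exact mul_le_mul ha (ih hs) (pow_nonneg hε _) (norm_nonneg _)

/-- The fibre of a nonconstant polynomial map over a point is contained in the root set of `P − a`.
[folklore] -/
theorem eval_eq_iff_isRoot_sub_C {F : Type*} [CommRing F] (P : F[X]) (a y : F) :
    P.eval y = a ↔ (P - Polynomial.C a).IsRoot y := by
  rw [Polynomial.IsRoot, eval_sub, eval_C, sub_eq_zero]

/-- A nonconstant polynomial self-map of a field has FINITE preimages of finite sets. [folklore] -/
theorem finite_preimage_eval {F : Type*} [Field F] (P : F[X]) (hP : 0 < P.natDegree) {X : Set F}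
    (hX : X.Finite) : ((fun u => P.eval u) ⁻¹' X).Finite := by
  classical
  have hsub : (fun u => P.eval u) ⁻¹' X ⊆ ⋃ a ∈ X, ((P - Polynomial.C a).roots.toFinset : Set F) := by
    intro y hy
    simp only [Set.mem_preimage] at hy
    refine Set.mem_biUnion hy ?_
    have hne : P - Polynomial.C (P.eval y) ≠ 0 := by
      intro h
      have h1 : (P - Polynomial.C (P.eval y)).natDegree = P.natDegree := natDegree_sub_C
      rw [h, natDegree_zero] at h1
      omega
    simp only [Finset.mem_coe, Multiset.mem_toFinset]
    exact (mem_roots hne).mpr ((eval_eq_iff_isRoot_sub_C P _ y).mp rfl)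
  exact Set.Finite.subset (Set.Finite.biUnion hX fun a _ => Finset.finite_toSet _) hsub

/-- **Localization for polynomial maps.**  Over an algebraically closed normed field (`ℂ`,
`PadicAlgCl p`), a polynomial map `u ↦ P(u)` of degree `n ≥ 1` with leading coefficient `c`
localizes at EVERY set `X`, with the explicit radius `δ = ‖c‖·ε^n`: `P(u) − a = c·∏(u − y)` over the
roots `y` of `P − a`, so `‖P(u) − a‖ < ‖c‖ ε^n` forces `‖u − y‖ < ε` for some root `y`, which lies
in `P ⁻¹' {a}`. [folklore] -/
theorem localizes_eval [IsAlgClosed K] (P : K[X]) (hP : 0 < P.natDegree) (X : Set K) :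
    ∀ ε > 0, ∃ δ > 0, ∀ u : K, (∃ x ∈ X, dist (P.eval u) x < δ) →
      ∃ y ∈ (fun u => P.eval u) ⁻¹' X, dist u y < ε := by
  intro ε hε
  have hP0 : P ≠ 0 := ne_zero_of_natDegree_gt hP
  have hc : P.leadingCoeff ≠ 0 := leadingCoeff_ne_zero.mpr hP0
  refine ⟨‖P.leadingCoeff‖ * ε ^ P.natDegree, by positivity, fun u hu => ?_⟩
  obtain ⟨a, haX, hd⟩ := hu
  set Q : K[X] := P - Polynomial.C a with hQdef
  have hQdeg : Q.natDegree = P.natDegree := natDegree_sub_C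
  have hQlc : Q.leadingCoeff = P.leadingCoeff := by
    rw [hQdef, sub_eq_add_neg, ← map_neg Polynomial.C a]
    exact leadingCoeff_add_of_degree_lt'
      (lt_of_le_of_lt degree_C_le (by
        rw [degree_eq_natDegree hP0]
        exact_mod_cast hP))
  have hsplit : Q.Splits := IsAlgClosed.splits Q
  have hcard : Q.natDegree = Multiset.card Q.roots := hsplit.natDegree_eq_card_roots
  -- the factorised evaluation
  have heval : Q.eval u = P.leadingCoeff * (Q.roots.map fun y => u - y).prod := by
    rw [hsplit.eval_eq_prod_roots u, hQlc]
  have hQu : ‖Q.eval u‖ < ‖P.leadingCoeff‖ * ε ^ P.natDegree := by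
    have : Q.eval u = P.eval u - a := by rw [hQdef, eval_sub, eval_C]
    rw [this, ← dist_eq_norm]; exact hd
  -- some root is `ε`-close to `u`
  by_contra hfar
  have hall : ∀ y ∈ Q.roots, ε ≤ ‖u - y‖ := by
    intro y hy
    by_contra hlt
    push Not at hlt
    apply hfar
    refine ⟨y, ?_, by rw [dist_eq_norm]; exact hlt⟩
    have hQ0 : Q ≠ 0 := by
      intro h; rw [h, natDegree_zero] at hQdeg; omega
    have hroot : Q.IsRoot y := (mem_roots hQ0).mp hy
    show P.eval y ∈ X
    rw [(eval_eq_iff_isRoot_sub_C P a y).mpr hroot]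
    exact haX
  have hge : ε ^ P.natDegree ≤ ‖(Q.roots.map fun y => u - y).prod‖ := by
    rw [← hQdeg, hcard]
    exact pow_card_le_norm_prod u hε.le Q.roots hall
  have : ‖P.leadingCoeff‖ * ε ^ P.natDegree ≤ ‖Q.eval u‖ := by
    rw [heval, norm_mul]
    exact mul_le_mul_of_nonneg_left hge (norm_nonneg _)
  exact absurd hQu (not_lt.mpr this)

end Poly

end Summit.ABC.ABC.Theorems.GenEllTwo.MenuCovering

end
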